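import Summits.QuantumFields.YangMills.Theorems.BalabanUVNodesPortS1G3CLocOpsBounds
import Summits.QuantumFields.YangMills.Theorems.BalabanUVNodesPortS1G3CLocOpsGauge
import Summits.QuantumFields.YangMills.Theorems.BalabanUVNodesPortS1G3CParametrix
import Summits.QuantumFields.YangMills.Theorems.BalabanUVNodesPortS1LZdetPiecesDefs
import Literature.MathematicalPhysics.QuantumFieldTheory.Balaban1983to89.TreeLengthTorusTransfer

/-!
# NODE O port PT-A — `stub_G3C` (repaired edition `G3CAtRecordL`), layer (D2): THE ONE-SIDED PARAMETRIX AT THE RECORD — `5^d` blocks `□̃ = tcollar (tblock □)`, the sharp partition `𝟙_□`,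
# the local operators `A_□ = x·P_□̃ + T^{(□̃)}`, their local inverses `G_□` (layer (D1)), the sticking-out remainders `E_□ := (x·1 + T)·P_□̃ − A_□`, the parametrix `C₀ := Σ_□ G_□𝟙_□` and
# `R := Σ_□ E_□G_□𝟙_□`, and THE IDENTITY `(x·1 + T)·C₀ = 1 + R` at every pair of the record spaces of the blocks, every `x ≥ 0` ([B9] (3.87)–(3.88)∕(3.95)–(3.96) at the record's complex carrier)

Cell `ym-nodeO-ideate`, porter hand `hand-27930-G3C` (g0); DEFINITION file (objects of the repaired road, memo `Cruxes/…/pta_residueW-stub_G3C-hand.md` §5b) + the algebraic letters;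
`--supports stmt-QuantumFields-27930 --as helper`; count-neutral.  [B9] = [Balaban1985BackgroundPropagators], [16] = [Balaban1985UV3], [I] = [Balaban1987RG1].

WHY.  With (D1) (✓`…G3CLocOps`∕`…Bounds`∕`…Gauge`) the local inverses `G_Z(x, φ)` are typed with all their letters; this layer assembles print's parametrix in the SHARP-partition form of the memo:
no Lipschitz partition of unity and no commutator — `Σ_□ 𝟙_□ = 1` trivially and the remainder is driven by the sticking-out pieces `E_□ = Σ_{Y ⊄ □̃, Y ∩ □̃ ≠ ∅} T_Y·P_□̃` alone (their smallness,
layer (D3), is ✓`…G3CStickOut` for `d_j(Y) ≥ 1` plus the lattice Combes–Thomas decay of ✓`norm_g3cLocInv_apply_le_exp` across one cube for `d_j(Y) = 0`).  The identity is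
✓`G3CInv.parametrix_identity_oneSided` fed by the local-inverse letter `A_□·G_□ = P_□̃` (unit block at `φ ∈ U^c(□̃)`, `x ≥ 0`), `P_□̃·G_□ = G_□`, and `P_□̃·𝟙_□ = 𝟙_□` (a site lies in the
site set of every domain containing its cube — the converse of ▶ PTA-1's ✓`cubeOfSite_blockOf_mem_of_embIter_mem_domSites`, proved here).

WHAT THIS FILE PROVES (sorry-free): geometry `embIter_mem_domSites_of_cubeOfSite_mem`, `isTDom_tcollar_tblock`, `g3cInDom_blk_of_cube_eq`; definitions `g3cBlk`, `g3cProj`, `g3cInd`, `g3cAq`,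
`g3cE`, `g3cC0`, `g3cR`; generic `G3CInv.extend_mul` ∕ `extend_one`; letters `g3cAq_eq_extend`, `g3cAq_mul_locInv`, `g3cProj_mul_locInv`, `g3cProj_mul_ind`, `sum_g3cInd`,
★ `g3c_parametrix_record` (`(x·1 + nonB0Block (TC φ))·C₀ = 1 + R`).

HONEST FRAMING.  Definitions + algebra under the HYPOTHESIS `P0CarrierClauses …` (inhabited nowhere); nothing of Bałaban's estimates asserted, ported or discharged; `stub_G3C` NOT closed;
27930 OPEN; NODE O 0∕1; COUNT 8∕28 · K 1∕4 UNMOVED; finite `𝕋⁴_{L^K}` at fixed ε — NOT continuum ∕ OS ∕ Clay; **the Yang–Mills mass gap is NOT proved by any of this.**  No `sorry`, no `instance`,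
no `notation`; standard axioms.
-/

noncomputable section

open scoped BigOperators Matrix.Norms.L2Operator Topology Matrix Classical
open Filter Finset

namespace Summit.QuantumFields.YangMills.Theorems.BalabanUVNodesPortS1

open Summit.QuantumFields.YangMills.Theorems.K0RecordFormatNames
open Literature.MathematicalPhysics.QuantumFieldTheory.Balaban1983to89
open Literature.MathematicalPhysics.QuantumFieldTheory.Balaban1983to89.Node00
open Literature.MathematicalPhysics.QuantumFieldTheory.Balaban1983to89.T4Continuum (T4Family)
open Literature.MathematicalPhysics.QuantumFieldTheory.Balaban1983to89.TreeLengthTorus (TPt IsTDom TFaceConnected tsys torusTreeLen)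
open Literature.MathematicalPhysics.QuantumFieldTheory.Balaban1983to89.TreeLengthTorusTransfer (tblock tcollar mem_tblock_self subset_tcollar tFaceConnected_tcollar tblock_subset_tcollar)
open Literature.MathematicalPhysics.QuantumFieldTheory.Balaban1983to89.B15Eq112TorusCover (cover cover_apply)
open Literature.MathematicalPhysics.QuantumFieldTheory.Balaban1983to89.B14.Eq213MaximalDomains (cubeExt side)

/-! ## §1  Geometry: a site lies in the sites of every domain containing its cube; the `5^d` block domain -/

section Geometry

variable {F : T4Family}

/-- **CONVERSE CUBE MAP**: a level-`k` site whose `Mc`-cube lies in `Y` has its fine representative in the sites of `Y` (tiled range) — the converse of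
✓`cubeOfSite_blockOf_mem_of_embIter_mem_domSites`. [cite: Balaban1987RG1, p.257 (the cubes π_j), (1.7) p.261] -/
theorem embIter_mem_domSites_of_cubeOfSite_mem {Mc k K : ℕ} (hMc : McGuard F Mc) (hK : recordK₀ F Mc k ≤ K) (Y : (recordDomSys F Mc k K).Dom)
    (x : Site (F.P K) k) (hq : cubeOfSite F Mc k K (blockOf x) ∈ (Y.1 : Finset (TPt (F.P K).d (Sect2.domCount (F.P K) Mc (k + 1))))) :
    B15DeterminingSets.embIter k x ∈ Sect2.domSites (F.P K) Mc (k + 1) Y := by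
  have hk := succ_le_m_add_K_of_recordK₀_le hK
  have hMc0 := PortHRecordRowG.mc_pos hMc
  have hL : 0 < F.L := by have := F.hL.2; omega
  rw [Sect2.domSites, Set.mem_iUnion₂]
  refine ⟨cubeOfSite F Mc k K (blockOf x), hq, ?_⟩
  set y := B15DeterminingSets.embIter k x with hy
  set s : ℕ := F.L ^ (k + 1) * Mc with hs
  have hs0 : 0 < s := by positivity
  have hside : side (F.P K).L Mc (k + 1) = s := rfl
  -- the `L^{k+1}Mc`-cube label of the fine representative is `⌊⌊x∕L⌋ ∕ Mc⌋`
  have hdiv2 : ∀ μ, (y μ).val / s = ((blockOf x) μ).val / Mc := fun μ => by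
    have hvx : (y μ).val / F.L ^ k = (x μ).val := B14.Eq213DetSet.val_embIter_div (by omega) x μ
    rw [Site.val_blockOf hk, hs, pow_succ, mul_assoc, ← Nat.div_div_eq_div_mul, hvx, Nat.div_div_eq_div_mul]
    rfl
  have hqval : ∀ μ, ((cubeOfSite F Mc k K (blockOf x)) μ).val = ((blockOf x) μ).val / Mc := fun μ => by
    show ((((blockOf x) μ).val / Mc : ℕ) : ZMod (Sect2.domCount (F.P K) Mc (k + 1))).val = _
    rw [ZMod.val_natCast, Nat.mod_eq_of_lt]
    have h := val_div_mul_lt_domCount hMc hK x μ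
    rw [Site.val_blockOf hk, Nat.div_div_eq_div_mul]
    exact h
  refine ⟨fun μ => ((y μ).val : ℤ), fun μ => ?_, ?_⟩
  · rw [hside, Nat.zero_mul, Nat.cast_zero, sub_zero, add_zero]
    have hliftq : Sect2.liftIdx (F.P K) (cubeOfSite F Mc k K (blockOf x)) μ = (((cubeOfSite F Mc k K (blockOf x)) μ).val : ℤ) := rfl
    rw [hliftq, hqval μ, ← hdiv2 μ]
    have h1 : s * ((y μ).val / s) ≤ (y μ).val := Nat.mul_div_le _ _
    have h2 : (y μ).val < (y μ).val / s * s + s := Nat.lt_div_mul_add hs0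
    have h1' : (s : ℤ) * (((y μ).val / s : ℕ) : ℤ) ≤ ((y μ).val : ℤ) := by exact_mod_cast h1
    have h2' : ((y μ).val : ℤ) < (((y μ).val / s : ℕ) : ℤ) * (s : ℤ) + (s : ℤ) := by exact_mod_cast h2
    constructor
    · exact h1'
    · show ((y μ).val : ℤ) ≤ (s : ℤ) * (((y μ).val / s : ℕ) : ℤ) + (s : ℤ) - 1
      linarith
  · rw [← coverAt_zero]; exact coverAt_valLift 0 y

/-- The `5^d` block `tcollar (tblock q)` is a localization domain (non-empty, wall-connected). [cite: Balaban1987RG1, p.257 (□̃, X̃)] -/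
theorem isTDom_tcollar_tblock {d N : ℕ} [NeZero N] (q : TPt d N) : IsTDom (tcollar (tblock q)) := by
  have h1 : TFaceConnected (tblock q) := by
    have e : tblock q = tcollar {q} := by simp [tcollar]
    rw [e]; exact tFaceConnected_tcollar (fun a ha b hb => by
      rw [Finset.mem_singleton] at ha hb; subst ha; subst hb; exact Relation.ReflTransGen.refl)
  exact ⟨⟨q, subset_tcollar _ (mem_tblock_self q)⟩, tFaceConnected_tcollar h1⟩

variable (F) in
/-- **The `5^d` block domain `□̃ := tcollar (tblock □)`** of a cube of `𝐃_{k+1}` (two layers of cubes around `□`; the block of the local inverses of the repaired road).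
[cite: Balaban1987RG1, p.257 (□̃ⁿ); Balaban1985BackgroundPropagators, (3.87) p.409] -/
def g3cBlk (Mc k K : ℕ) (q : TPt (F.P K).d (Sect2.domCount (F.P K) Mc (k + 1))) : (recordDomSys F Mc k K).Dom :=
  ⟨tcollar (tblock q), isTDom_tcollar_tblock q⟩

/-- `□ ∈ □̃`. [folklore] -/
theorem mem_g3cBlk_self (Mc k K : ℕ) (q : TPt (F.P K).d (Sect2.domCount (F.P K) Mc (k + 1))) : q ∈ (g3cBlk F Mc k K q).1 :=
  subset_tcollar _ (mem_tblock_self q)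

/-- An index whose cube is `q` lies in the block domain `□̃(q)`. [cite: Balaban1987RG1, p.257] -/
theorem g3cInDom_blk_of_cube_eq {Mc k K : ℕ} (hMc : McGuard F Mc) (hK : recordK₀ F Mc k ≤ K) {q : TPt (F.P K).d (Sect2.domCount (F.P K) Mc (k + 1))}
    {i : NonB0Idx F k K} (h : cubeOfSite F Mc k K (blockOf i.1.1.src) = q) : g3cInDom F Mc k K (g3cBlk F Mc k K q) i := by
  unfold g3cInDom
  exact embIter_mem_domSites_of_cubeOfSite_mem hMc hK _ _ (by rw [h]; exact mem_g3cBlk_self Mc k K q)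

end Geometry

/-! ## §2  The objects of the one-sided parametrix at volume `K` -/

section Objects

variable (F : T4Family)

/-- The coordinate projection `P_Z` onto the indices of `Z`. [cite: Balaban1985BackgroundPropagators, (3.88) p.409] -/
def g3cProj (Mc k K : ℕ) (Z : (recordDomSys F Mc k K).Dom) : Matrix (NonB0Idx F k K) (NonB0Idx F k K) ℂ :=
  Matrix.diagonal fun i => if g3cInDom F Mc k K Z i then 1 else 0

/-- The SHARP PARTITION `𝟙_□`: the coordinate projection onto the indices whose cube is `□`. [cite: Balaban1985BackgroundPropagators, (3.87) p.409 (with h_□ = 𝟙_□)] -/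
def g3cInd (Mc k K : ℕ) (q : TPt (F.P K).d (Sect2.domCount (F.P K) Mc (k + 1))) : Matrix (NonB0Idx F k K) (NonB0Idx F k K) ℂ :=
  Matrix.diagonal fun i => (((if cubeOfSite F Mc k K (blockOf i.1.1.src) = q then (1 : ℝ) else 0) : ℝ) : ℂ)

/-- **The local operator `A_□(x, φ) := x·P_□̃ + T^{(□̃)}(φ)`** on the non-`b₀` index. [cite: Balaban1985BackgroundPropagators, (3.88) p.409] -/
def g3cAq (Mc k K : ℕ) (TYK : (recordDomSys F Mc k K).Dom → Sect2.CPair (F.P K) (MatA 2) → FluctIdx F k K → FluctIdx F k K → ℂ)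
    (q : TPt (F.P K).d (Sect2.domCount (F.P K) Mc (k + 1))) (x : ℝ) (φ : Sect2.CPair (F.P K) (MatA 2)) : Matrix (NonB0Idx F k K) (NonB0Idx F k K) ℂ :=
  (x : ℂ) • g3cProj F Mc k K (g3cBlk F Mc k K q) + g3cLocOp F Mc k K TYK (g3cBlk F Mc k K q) φ

/-- **The sticking-out remainder `E_□(x, φ) := (x·1 + T(φ))·P_□̃ − A_□(x, φ)`** (`= Σ_{Y ⊄ □̃} T_Y(φ)·P_□̃`). [cite: Balaban1985BackgroundPropagators, (3.95) p.411] -/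
def g3cE (Mc k K : ℕ) (TCK : Sect2.CPair (F.P K) (MatA 2) → FluctIdx F k K → FluctIdx F k K → ℂ)
    (TYK : (recordDomSys F Mc k K).Dom → Sect2.CPair (F.P K) (MatA 2) → FluctIdx F k K → FluctIdx F k K → ℂ)
    (q : TPt (F.P K).d (Sect2.domCount (F.P K) Mc (k + 1))) (x : ℝ) (φ : Sect2.CPair (F.P K) (MatA 2)) : Matrix (NonB0Idx F k K) (NonB0Idx F k K) ℂ :=
  ((x : ℂ) • (1 : Matrix _ _ ℂ) + nonB0Block F k K (TCK φ)) * g3cProj F Mc k K (g3cBlk F Mc k K q) - g3cAq F Mc k K TYK q x φ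

/-- **The parametrix `C₀(x, φ) := Σ_□ G_□(x, φ)·𝟙_□`.** [cite: Balaban1985BackgroundPropagators, (3.87) p.409] -/
def g3cC0 (Mc k K : ℕ) (TYK : (recordDomSys F Mc k K).Dom → Sect2.CPair (F.P K) (MatA 2) → FluctIdx F k K → FluctIdx F k K → ℂ)
    (x : ℝ) (φ : Sect2.CPair (F.P K) (MatA 2)) : Matrix (NonB0Idx F k K) (NonB0Idx F k K) ℂ :=
  ∑ q : TPt (F.P K).d (Sect2.domCount (F.P K) Mc (k + 1)), g3cLocInv F Mc k K TYK (g3cBlk F Mc k K q) x φ * g3cInd F Mc k K q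

/-- **The remainder `R(x, φ) := Σ_□ E_□(x, φ)·G_□(x, φ)·𝟙_□`.** [cite: Balaban1985BackgroundPropagators, (3.88) p.409, (3.95)–(3.96) p.411] -/
def g3cR (Mc k K : ℕ) (TCK : Sect2.CPair (F.P K) (MatA 2) → FluctIdx F k K → FluctIdx F k K → ℂ)
    (TYK : (recordDomSys F Mc k K).Dom → Sect2.CPair (F.P K) (MatA 2) → FluctIdx F k K → FluctIdx F k K → ℂ)
    (x : ℝ) (φ : Sect2.CPair (F.P K) (MatA 2)) : Matrix (NonB0Idx F k K) (NonB0Idx F k K) ℂ :=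
  ∑ q : TPt (F.P K).d (Sect2.domCount (F.P K) Mc (k + 1)), g3cE F Mc k K TCK TYK q x φ * g3cLocInv F Mc k K TYK (g3cBlk F Mc k K q) x φ * g3cInd F Mc k K q

end Objects

/-! ## §3  Extensions by zero (generic) -/

namespace G3CInv

variable {ι : Type*} [Fintype ι] [DecidableEq ι] {R : Type*} [CommRing R]

omit [DecidableEq ι] in
/-- Product of two extensions by zero = extension of the product. [folklore] -/
theorem extend_mul {p : ι → Prop} [DecidablePred p] (M N : Matrix {i // p i} {i // p i} R) :
    (Matrix.of fun i j : ι => if hi : p i then (if hj : p j then M ⟨i, hi⟩ ⟨j, hj⟩ else 0) else 0) *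
      (Matrix.of fun i j : ι => if hi : p i then (if hj : p j then N ⟨i, hi⟩ ⟨j, hj⟩ else 0) else 0) =
      Matrix.of fun i j : ι => if hi : p i then (if hj : p j then (M * N) ⟨i, hi⟩ ⟨j, hj⟩ else 0) else 0 := by
  ext i j
  rw [Matrix.mul_apply, Matrix.of_apply]
  by_cases hi : p i
  · by_cases hj : p j
    · rw [dif_pos hi, dif_pos hj, Matrix.mul_apply]
      rw [← Fintype.sum_subtype_add_sum_subtype p (fun l => (Matrix.of fun i j : ι => if hi : p i then (if hj : p j then M ⟨i, hi⟩ ⟨j, hj⟩ else 0) else 0) i l *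
        (Matrix.of fun i j : ι => if hi : p i then (if hj : p j then N ⟨i, hi⟩ ⟨j, hj⟩ else 0) else 0) l j)]
      rw [Finset.sum_eq_zero (s := (Finset.univ : Finset {l // ¬ p l})) (fun l _ => by
        rw [Matrix.of_apply, Matrix.of_apply, dif_pos hi, dif_neg l.2, zero_mul]), add_zero]
      refine Finset.sum_congr rfl fun l _ => ?_
      rw [Matrix.of_apply, Matrix.of_apply, dif_pos hi, dif_pos l.2, dif_pos l.2, dif_pos hj]
    · rw [dif_pos hi, dif_neg hj]
      exact Finset.sum_eq_zero fun l _ => by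
        rw [Matrix.of_apply (f := fun i j : ι => if hi : p i then (if hj : p j then N ⟨i, hi⟩ ⟨j, hj⟩ else 0) else 0)]
        by_cases hl : p l
        · rw [dif_pos hl, dif_neg hj, mul_zero]
        · rw [dif_neg hl, mul_zero]
  · rw [dif_neg hi]
    exact Finset.sum_eq_zero fun l _ => by rw [Matrix.of_apply, dif_neg hi, zero_mul]

omit [Fintype ι] in
/-- The extension by zero of the identity is the coordinate projection. [folklore] -/
theorem extend_one {p : ι → Prop} [DecidablePred p] :
    (Matrix.of fun i j : ι => if hi : p i then (if hj : p j then (1 : Matrix {i // p i} {i // p i} R) ⟨i, hi⟩ ⟨j, hj⟩ else 0) else 0) =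
      Matrix.diagonal fun i => if p i then (1 : R) else 0 := by
  ext i j
  rw [Matrix.of_apply]
  by_cases hi : p i
  · by_cases hj : p j
    · rw [dif_pos hi, dif_pos hj]
      by_cases hij : i = j
      · subst hij; rw [Matrix.one_apply_eq, Matrix.diagonal_apply_eq, if_pos hi]
      · rw [Matrix.one_apply_ne (fun h => hij (congrArg Subtype.val h)), Matrix.diagonal_apply_ne _ hij]
    · rw [dif_pos hi, dif_neg hj]
      have hij : i ≠ j := fun h => hj (h ▸ hi)
      rw [Matrix.diagonal_apply_ne _ hij]
  · rw [dif_neg hi]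
    by_cases hij : i = j
    · subst hij; rw [Matrix.diagonal_apply_eq, if_neg hi]
    · rw [Matrix.diagonal_apply_ne _ hij]

/-- `P · ext(N) = ext(N)`. [folklore] -/
theorem proj_mul_extend {p : ι → Prop} [DecidablePred p] (N : Matrix {i // p i} {i // p i} R) :
    (Matrix.diagonal fun i => if p i then (1 : R) else 0) *
      (Matrix.of fun i j : ι => if hi : p i then (if hj : p j then N ⟨i, hi⟩ ⟨j, hj⟩ else 0) else 0) =
      Matrix.of fun i j : ι => if hi : p i then (if hj : p j then N ⟨i, hi⟩ ⟨j, hj⟩ else 0) else 0 := by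
  rw [← extend_one, extend_mul, Matrix.one_mul]

end G3CInv

/-! ## §4  The letters and the identity `(x·1 + T)·C₀ = 1 + R` -/

section Identity

variable {F : T4Family}
variable {a₀ δ₀ c₀ γ₀ γ₁ : ℝ} {Mc : ℕ} {α₀ α₁ ε₂₉ : ℝ} {k : ℕ}
variable {TC : (n : ℕ) → Sect2.CPair (F.P (recordK₀ F Mc k + n)) (MatA 2) → FluctIdx F k (recordK₀ F Mc k + n) → FluctIdx F k (recordK₀ F Mc k + n) → ℂ}
variable {TY : (n : ℕ) → (recordDomSys F Mc k (recordK₀ F Mc k + n)).Dom → Sect2.CPair (F.P (recordK₀ F Mc k + n)) (MatA 2) →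
  FluctIdx F k (recordK₀ F Mc k + n) → FluctIdx F k (recordK₀ F Mc k + n) → ℂ}
variable {TZY : Finset (Fin 4 → ℤ) → IntBondCfg → ((Fin 4 → ℤ) × Fin 4) × Fin 3 → ((Fin 4 → ℤ) × Fin 4) × Fin 3 → ℂ}
variable {AdM : (n : ℕ) → (Site (F.P (recordK₀ F Mc k + n)) 0 → (MatA 2)ˣ) →
  Matrix (FluctIdx F k (recordK₀ F Mc k + n)) (FluctIdx F k (recordK₀ F Mc k + n)) ℂ}
variable {AdZ : ((Fin 4 → ℤ) → (MatA 2)ˣ) → (Fin 4 → ℤ) × Fin 4 → Matrix (Fin 3) (Fin 3) ℂ}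

/-- `A_□(x, φ)` is the extension by zero of the restricted resolvent block `x·1 + T^{(□̃)}(φ)|_□̃`. [cite: Balaban1985BackgroundPropagators, (3.88) p.409 (bookkeeping)] -/
theorem g3cAq_eq_extend (hP : P0CarrierClauses F a₀ δ₀ c₀ γ₀ γ₁ Mc α₀ α₁ ε₂₉ k TC TY TZY AdM AdZ) (n : ℕ)
    (q : TPt (F.P (recordK₀ F Mc k + n)).d (Sect2.domCount (F.P (recordK₀ F Mc k + n)) Mc (k + 1))) (x : ℝ) (φ : Sect2.CPair (F.P (recordK₀ F Mc k + n)) (MatA 2)) :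
    g3cAq F Mc k (recordK₀ F Mc k + n) (TY n) q x φ = Matrix.of fun i j : NonB0Idx F k (recordK₀ F Mc k + n) =>
      if hi : g3cInDom F Mc k (recordK₀ F Mc k + n) (g3cBlk F Mc k (recordK₀ F Mc k + n) q) i then
        (if hj : g3cInDom F Mc k (recordK₀ F Mc k + n) (g3cBlk F Mc k (recordK₀ F Mc k + n) q) j then
          g3cLocBlock F Mc k (recordK₀ F Mc k + n) (TY n) (g3cBlk F Mc k (recordK₀ F Mc k + n) q) x φ ⟨i, hi⟩ ⟨j, hj⟩ else 0) else 0 := by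
  ext i j
  rw [g3cAq, g3cProj, Matrix.add_apply, Matrix.smul_apply, Matrix.of_apply]
  by_cases hi : g3cInDom F Mc k (recordK₀ F Mc k + n) (g3cBlk F Mc k (recordK₀ F Mc k + n) q) i
  · by_cases hj : g3cInDom F Mc k (recordK₀ F Mc k + n) (g3cBlk F Mc k (recordK₀ F Mc k + n) q) j
    · rw [dif_pos hi, dif_pos hj, g3cLocBlock, Matrix.add_apply, Matrix.smul_apply, Matrix.submatrix_apply]
      by_cases hij : i = j
      · subst hij
        rw [Matrix.diagonal_apply_eq, if_pos hi, Matrix.one_apply_eq]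
      · rw [Matrix.diagonal_apply_ne _ hij, Matrix.one_apply_ne (fun h => hij (congrArg Subtype.val h))]
    · rw [dif_pos hi, dif_neg hj, g3cLocOp_apply_eq_zero_right hP n _ φ i hj]
      have hij : i ≠ j := fun h => hj (h ▸ hi)
      rw [Matrix.diagonal_apply_ne _ hij, smul_zero, add_zero]
  · rw [dif_neg hi, g3cLocOp_apply_eq_zero_left hP n _ φ hi j, add_zero]
    by_cases hij : i = j
    · subst hij; rw [Matrix.diagonal_apply_eq, if_neg hi, smul_zero]
    · rw [Matrix.diagonal_apply_ne _ hij, smul_zero]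

/-- ★ **THE LOCAL-INVERSE LETTER `A_□·G_□ = P_□̃`** at a pair of the record space of `□̃`, `x ≥ 0`. [cite: Balaban1985BackgroundPropagators, (3.88) p.409] -/
theorem g3cAq_mul_locInv (hP : P0CarrierClauses F a₀ δ₀ c₀ γ₀ γ₁ Mc α₀ α₁ ε₂₉ k TC TY TZY AdM AdZ) (hγ₀ : 0 < γ₀) (n : ℕ)
    (q : TPt (F.P (recordK₀ F Mc k + n)).d (Sect2.domCount (F.P (recordK₀ F Mc k + n)) Mc (k + 1))) {φ : Sect2.CPair (F.P (recordK₀ F Mc k + n)) (MatA 2)}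
    (hφ : encodeCfg F (recordK₀ F Mc k + n) φ ∈ recordUc F Mc k α₀ α₁ (recordK₀ F Mc k + n) (g3cBlk F Mc k (recordK₀ F Mc k + n) q)) {x : ℝ} (hx : 0 ≤ x) :
    g3cAq F Mc k (recordK₀ F Mc k + n) (TY n) q x φ * g3cLocInv F Mc k (recordK₀ F Mc k + n) (TY n) (g3cBlk F Mc k (recordK₀ F Mc k + n) q) x φ =
      g3cProj F Mc k (recordK₀ F Mc k + n) (g3cBlk F Mc k (recordK₀ F Mc k + n) q) := by
  rw [g3cAq_eq_extend hP n q x φ, g3cLocInv_eq_extend, G3CInv.extend_mul,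
    Matrix.mul_nonsing_inv _ (isUnit_det_g3cLocBlock hP hγ₀ n _ hφ hx), G3CInv.extend_one]
  rfl

/-- `P_□̃·G_□ = G_□`. [cite: Balaban1985BackgroundPropagators, (3.88) p.409] -/
theorem g3cProj_mul_locInv (Mc k K : ℕ) (TYK : (recordDomSys F Mc k K).Dom → Sect2.CPair (F.P K) (MatA 2) → FluctIdx F k K → FluctIdx F k K → ℂ)
    (Z : (recordDomSys F Mc k K).Dom) (x : ℝ) (φ : Sect2.CPair (F.P K) (MatA 2)) :
    g3cProj F Mc k K Z * g3cLocInv F Mc k K TYK Z x φ = g3cLocInv F Mc k K TYK Z x φ := by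
  rw [g3cLocInv_eq_extend, g3cProj, G3CInv.proj_mul_extend]

/-- `P_□̃·𝟙_□ = 𝟙_□` (an index of cube `□` lies in `□̃`). [cite: Balaban1987RG1, p.257] -/
theorem g3cProj_mul_ind {Mc k K : ℕ} (hMc : McGuard F Mc) (hK : recordK₀ F Mc k ≤ K) (q : TPt (F.P K).d (Sect2.domCount (F.P K) Mc (k + 1))) :
    g3cProj F Mc k K (g3cBlk F Mc k K q) * g3cInd F Mc k K q = g3cInd F Mc k K q := by
  rw [g3cProj, g3cInd]
  exact G3CInv.proj_mul_diag_of_supp (ι := NonB0Idx F k K)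
    (fun i : NonB0Idx F k K => if cubeOfSite F Mc k K (blockOf i.1.1.src) = q then (1 : ℝ) else 0)
    (fun i : NonB0Idx F k K => g3cInDom F Mc k K (g3cBlk F Mc k K q) i)
    (fun i hi => by
      by_cases h : cubeOfSite F Mc k K (blockOf i.1.1.src) = q
      · exact absurd (g3cInDom_blk_of_cube_eq hMc hK h) hi
      · rw [if_neg h])

/-- `Σ_□ 𝟙_□ = 1` (every index has exactly one cube). [folklore] -/
theorem sum_g3cInd (Mc k K : ℕ) : ∑ q : TPt (F.P K).d (Sect2.domCount (F.P K) Mc (k + 1)), g3cInd F Mc k K q = 1 := by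
  simp only [g3cInd]
  exact G3CInv.sum_diag_eq_one Finset.univ (fun q (i : NonB0Idx F k K) => if cubeOfSite F Mc k K (blockOf i.1.1.src) = q then (1 : ℝ) else 0)
    (fun i => by rw [Finset.sum_ite_eq, if_pos (Finset.mem_univ _)])

/-- ★★ **THE ONE-SIDED PARAMETRIX IDENTITY AT THE RECORD**: for `x ≥ 0` and every pair `φ` lying in the record space of every `5^d` block,
`(x·1 + nonB0Block (TC n φ))·C₀(x, φ) = 1 + R(x, φ)` ([B9] (3.88)∕(3.96) with the sharp partition — NO commutator term). [cite: Balaban1985BackgroundPropagators, (3.87)–(3.88) p.409, (3.95)–(3.96) p.411] -/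
theorem g3c_parametrix_record (hP : P0CarrierClauses F a₀ δ₀ c₀ γ₀ γ₁ Mc α₀ α₁ ε₂₉ k TC TY TZY AdM AdZ) (hγ₀ : 0 < γ₀) (hMc : McGuard F Mc) (n : ℕ)
    {φ : Sect2.CPair (F.P (recordK₀ F Mc k + n)) (MatA 2)}
    (hφ : ∀ q, encodeCfg F (recordK₀ F Mc k + n) φ ∈ recordUc F Mc k α₀ α₁ (recordK₀ F Mc k + n) (g3cBlk F Mc k (recordK₀ F Mc k + n) q)) {x : ℝ} (hx : 0 ≤ x) :
    ((x : ℂ) • (1 : Matrix _ _ ℂ) + nonB0Block F k (recordK₀ F Mc k + n) (TC n φ)) * g3cC0 F Mc k (recordK₀ F Mc k + n) (TY n) x φ =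
      1 + g3cR F Mc k (recordK₀ F Mc k + n) (TC n) (TY n) x φ := by
  have hK : recordK₀ F Mc k ≤ recordK₀ F Mc k + n := Nat.le_add_right _ _
  rw [g3cC0, g3cR]
  simp only [g3cInd]
  refine G3CInv.parametrix_identity_oneSided Finset.univ _ (fun q (i : NonB0Idx F k (recordK₀ F Mc k + n)) =>
      if cubeOfSite F Mc k (recordK₀ F Mc k + n) (blockOf i.1.1.src) = q then (1 : ℝ) else 0)
    (fun q => g3cLocInv F Mc k (recordK₀ F Mc k + n) (TY n) (g3cBlk F Mc k (recordK₀ F Mc k + n) q) x φ)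
    (fun q => g3cProj F Mc k (recordK₀ F Mc k + n) (g3cBlk F Mc k (recordK₀ F Mc k + n) q))
    (fun q => g3cE F Mc k (recordK₀ F Mc k + n) (TC n) (TY n) q x φ)
    (fun i => by rw [Finset.sum_ite_eq, if_pos (Finset.mem_univ _)]) (fun q _ => ?_) (fun q _ => ?_)
  · have h := g3cProj_mul_ind (F := F) hMc hK q
    rw [g3cInd] at h
    exact h
  · exact G3CInv.localInverse_letter _ (g3cAq F Mc k (recordK₀ F Mc k + n) (TY n) q x φ) _ _ _
      (g3cAq_mul_locInv hP hγ₀ n q (hφ q) hx) (g3cProj_mul_locInv Mc k _ (TY n) _ x φ) rfl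

end Identity

end Summit.QuantumFields.YangMills.Theorems.BalabanUVNodesPortS1

end
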